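import Summits.BirchSwinnertonDyer.BirchSwinnertonDyer.Theorems.ThetaPartnerAtTwoSignedKatoUpToAtTwoOfPubKatoOnly
import Literature.NumberTheory.EllipticCurves.PAdicBSDKatoFiniteVariableChangeProofs
import HarnessLib

/-!
# Route `ThetaPartnerAtTwo` (TP2) / `ResidualThetaTransportAtTwo` (RTT), crux K3 `SignedKatoDivisibilityUpToAtTwo`
# (stmt-BirchSwinnertonDyer-20308), line `colemanrat` v16 — the Kato-only rank-zero reading with bsd.S20 bound on
# GLOBALLY MINIMAL equations only, and why that changes nothing

Width seat `bsd-wall-tp2-p2x-w2` g29 (cell `bsd-wall`). Appendix to `…OfPubKatoOnly` §2/§4 (width seat w3 g10), whose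
readings `KatoBK.signedKatoDivisibilityUpToAtTwo_of_kato2004_cor143_facts` / `…_rtt_of_kato2004_cor143_facts` take
`hS20 : ∀ (W : WeierstrassCurve ℚ) [W.IsElliptic], kato_finite_of_L_one_ne_zero W 2` — bsd.S20 (Kato, Astérisque 295,
Cor. 14.3 at `K = ℚ`, `χ = 1`, `p = 2`) for EVERY elliptic Weierstrass equation over `ℚ`, minimal or not. The route pen's
junk-dependence pre-census (R-128, 2026-08-29) flagged that binder as typed wider than the fact's documented scope
(`[W.IsGloballyMinimal]`). HONEST FRAMING: COMPOSITIONS ONLY — no definition, no named fact, no instance, no `sorry`;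
CONDITIONAL theorems displaying three EXISTING named Literature facts, none proved in the tree; nothing is closed; K3 / K3P′
are NOT settled; BSD is NOT proved by this.

## What is proved

* `signedKatoDivisibilityUpToAtTwo_of_kato2004_cor143_min_facts` — **K3 (TP2 decl) BY NAME ⟸
  {`Kato2004.thm13_4_two_lengthAt_fineSelmerDualContra_le_of_isEulerSystemClassTwo`, bsd.S20 ON GLOBALLY MINIMAL EQUATIONS
  `∀ (W) [W.IsElliptic] [W.IsGloballyMinimal], kato_finite_of_L_one_ne_zero W 2`, `Kato2004.exists_eulerSystem_expStar_tatePairing_values_two`}**;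
  `…_rtt_of_kato2004_cor143_min_facts` the same on the RTT decl.
* The proof is the w3 g10 reading fed through the tree theorem
  `forall_kato_finite_of_L_one_ne_zero_of_forall_isGloballyMinimal` (`Literature…PAdicBSDKatoFiniteVariableChangeProofs`):
  bsd.S20 is invariant under admissible changes of variables `C • W` — Mathlib's `WeierstrassCurve.LFunction` is the Euler
  product of local factors computed on LOCAL MINIMAL MODELS (`entireLFunction_smul`), `W(ℚ) ≃ (C • W)(ℚ)`, `Ш ≃ Ш` (`shaEquiv`)
  — and every elliptic equation over `ℚ` has a global minimal model (`hasGlobalMinimalModel_rat_holds`, Silverman *AEC*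
  Cor. VIII.8.3). So the wide binder of `…OfPubKatoOnly` and the minimal-only binder here are EQUIVALENT hypotheses
  (`forall_kato_finite_of_L_one_ne_zero_iff_forall_isGloballyMinimal`): no junk value of `W.entireLFunction` enters the wide
  one, and the two certificates are interchangeable.

References: [Kato2004Asterisque] Thm. 12.5 (1) (pp. 221–222), Thm. 13.4 (2) (p. 226), Thm. 14.2 (2) and Cor. 14.3 (p. 235),
Thm. 14.5 (1) (p. 236); [SilvermanAEC2009] Cor. VIII.8.3 (p. 213), X.§4, App. C §16; [Kobayashi2003] Prop. 8.25;
[Rubin1998Durham] Thm. 7.1.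
-/

set_option autoImplicit false
-- the Theorems namespace of this sub repeats the summit name by design (D-0017 nested layout)
set_option linter.dupNamespace false

noncomputable section

open WeierstrassCurve Literature.NumberTheory.EllipticCurves Literature.NumberTheory.EllipticCurves.Kato2004

namespace Summit.BirchSwinnertonDyer.BirchSwinnertonDyer.Theorems.SignedKatoOffTwo.KatoBK

/-- **K3 (TP2 decl `SignedKatoDivisibilityUpToAtTwo`, item stmt-BirchSwinnertonDyer-20308) BY NAME ⟸ THREE NAMED THEOREMS OF
KATO, Astérisque 295 (2004), the rank-zero reading with bsd.S20 bound on GLOBALLY MINIMAL equations only:** Thm. 13.4 (2) at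
`p = 2` (`Kato2004.thm13_4_two_lengthAt_fineSelmerDualContra_le_of_isEulerSystemClassTwo`), Cor. 14.3 / Thm. 14.2 (2) at the
trivial character over `ℚ`, `p = 2`, for globally minimal elliptic `W` (`∀ (W) [W.IsElliptic] [W.IsGloballyMinimal],
kato_finite_of_L_one_ne_zero W 2`: `L(E, 1) ≠ 0 ⇒ E(ℚ)`, `Ш[2^∞]`, `Sel_{2^∞}(E/ℚ)` finite), and Thm. 12.5 (1) with
(8.1.3)/Ex. 13.3 read on the layer Tate pairing at `2` (`Kato2004.exists_eulerSystem_expStar_tatePairing_values_two`). Proof: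
the minimal-only binder implies the all-equations binder (`forall_kato_finite_of_L_one_ne_zero_of_forall_isGloballyMinimal`:
bsd.S20 is invariant under `C • W` and every elliptic `W/ℚ` has a global minimal model), then
`signedKatoDivisibilityUpToAtTwo_of_kato2004_cor143_facts` verbatim. No Gross–Zagier, no Kolyvagin; CONDITIONAL on the three
displayed facts (none proved in the tree); closes nothing by itself; BSD is not proved by this.
[cite: Kato2004Asterisque, Thm. 12.5 (1) (pp. 221–222), Thm. 13.4 (2) (p. 226), Thm. 14.2 (2) and Cor. 14.3 (p. 235), Thm. 14.5 (1) (p. 236)]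
[cite: SilvermanAEC2009, Cor. VIII.8.3 (p. 213)] [cite: Kobayashi2003, Prop. 8.25] [cite: Rubin1998Durham, Thm. 7.1] -/
theorem signedKatoDivisibilityUpToAtTwo_of_kato2004_cor143_min_facts
    (hK2 : Kato2004.thm13_4_two_lengthAt_fineSelmerDualContra_le_of_isEulerSystemClassTwo)
    (hS20 : ∀ (W : WeierstrassCurve ℚ) [W.IsElliptic] [W.IsGloballyMinimal], kato_finite_of_L_one_ne_zero W 2)
    (hF : Kato2004.exists_eulerSystem_expStar_tatePairing_values_two) :
    Summit.BirchSwinnertonDyer.BirchSwinnertonDyer.Theses.ThetaPartnerAtTwo.SignedKatoDivisibilityUpToAtTwo :=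
  signedKatoDivisibilityUpToAtTwo_of_kato2004_cor143_facts hK2
    (fun W _ ↦ forall_kato_finite_of_L_one_ne_zero_of_forall_isGloballyMinimal 2 (fun V _ _ ↦ hS20 V) W) hF

/-- RTT reading of `signedKatoDivisibilityUpToAtTwo_of_kato2004_cor143_min_facts` (byte-identical body of the route decl): K3
(RTT decl) ⟸ {Kato 13.4 (2)@2, bsd.S20 on globally minimal equations (Kato Cor. 14.3@2), Kato 12.5-package}, no
Gross–Zagier–Kolyvagin. CONDITIONAL; closes nothing by itself; BSD is not proved by this.
[cite: Kato2004Asterisque, Thm. 13.4 (2) (p. 226), Cor. 14.3 (p. 235), Thm. 12.5 (1) (pp. 221–222)]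
[cite: SilvermanAEC2009, Cor. VIII.8.3 (p. 213)] -/
theorem signedKatoDivisibilityUpToAtTwo_rtt_of_kato2004_cor143_min_facts
    (hK2 : Kato2004.thm13_4_two_lengthAt_fineSelmerDualContra_le_of_isEulerSystemClassTwo)
    (hS20 : ∀ (W : WeierstrassCurve ℚ) [W.IsElliptic] [W.IsGloballyMinimal], kato_finite_of_L_one_ne_zero W 2)
    (hF : Kato2004.exists_eulerSystem_expStar_tatePairing_values_two) :
    Summit.BirchSwinnertonDyer.BirchSwinnertonDyer.Theses.ResidualThetaTransportAtTwo.SignedKatoDivisibilityUpToAtTwo :=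
  signedKatoDivisibilityUpToAtTwo_of_kato2004_cor143_min_facts hK2 hS20 hF

/-- **The two bsd.S20 binders of the Kato-only rank-zero reading are interchangeable**: the wide hypothesis of
`signedKatoDivisibilityUpToAtTwo_of_kato2004_cor143_facts` (bsd.S20 for every elliptic equation over `ℚ`) and the
minimal-only hypothesis of `signedKatoDivisibilityUpToAtTwo_of_kato2004_cor143_min_facts` are EQUIVALENT propositions
(`forall_kato_finite_of_L_one_ne_zero_iff_forall_isGloballyMinimal`), so neither reading is stronger than the other and no junk
value enters the wide one. [cite: SilvermanAEC2009, Cor. VIII.8.3 (p. 213), App. C §16] [cite: Kato2004Asterisque, Cor. 14.3 (p. 235)] -/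
theorem kato_cor143_binder_two_iff_min :
    (∀ (W : WeierstrassCurve ℚ) [W.IsElliptic], kato_finite_of_L_one_ne_zero W 2) ↔
      ∀ (W : WeierstrassCurve ℚ) [W.IsElliptic] [W.IsGloballyMinimal], kato_finite_of_L_one_ne_zero W 2 :=
  forall_kato_finite_of_L_one_ne_zero_iff_forall_isGloballyMinimal 2

end Summit.BirchSwinnertonDyer.BirchSwinnertonDyer.Theorems.SignedKatoOffTwo.KatoBK

end
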